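import Summits.CriticalPhenomena.PercolationContinuityZ3.Theorems.Transplant.PlanarSkeletonFrmFromDefs
import Summits.CriticalPhenomena.PercolationContinuityZ3.Theorems.Transplant.SkelFrmFrom1ChoiceLT
import Summits.CriticalPhenomena.PercolationContinuityZ3.Theorems.Transplant.SkelFrm1ChoiceLT
import HarnessLib
import Summits.CriticalPhenomena.PercolationContinuityZ3.Theorems.Transplant.SkelPhiFaceChainFactLT
/-!
# U-WAVE PORT (RULING D-U, lead g21 2026-08-26; WAVE-U-MANIFEST v3.0 row «SkelPhiFaceChainFactLT» ↦ «SkelPhiFaceChainFactLTFrom») of the tree module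
# `Transplant/SkelPhiFaceChainFactLT` onto the carrier `PlanarSkeletonFrmFrom` (frames only, cylinders connected from width `ℓ₀` on)

ORIGINAL TITLE: N2 (frames-only node `SamePDropOfSkeletonFrm₁`, OPEN), (F) column under (R-32) (J10 ruled, p3-g16 2026-08-23T01:40:38Z; p5 sieve PASS 01:38:26Z):

builds on p205010 (kernel theorem, internal audit signed; external expert review pending) — nothing in this file uses p205010; NOTHING is claimed about the
OPEN node U `SamePDropOfSkeletonFrmFrom₁` (nor U_s / the end state).  Lane `prim-bschramm`, seat `prim-hp-8 gen 53 (U-wave port pen; tool of record = p3-g26 port_u.py)`; helper file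
(`--supports stmt-CriticalPhenomena-4575 --as helper`).  PORT RULES r1–r4 of RULING D-U: declaration order and proof texts are those of the original,
byte-identical except (i) the carrier token `PlanarSkeletonFrm ↦ PlanarSkeletonFrmFrom` (binders, `namespace`/`end` lines, qualified names of twinned
declarations), (ii) carrier-FREE declarations of the original (φ-level `Skelφ…` blocks and namespace-only arithmetic residents) are NOT re-declared —
this file imports the original and `export`s the twin-free residents (POLICY T / treatment (m1)); residents whose statement mentions a twinned
constant are copied, (iii) every carrier-binding declaration keeps its explicit binder `(Φ : PlanarSkeletonFrmFrom G)` in its own signature (r2).  Docstrings and citations are the original's.  Manifest row idx 34 (level 6; flags verbatim|RESIDENTS(T:0/free:1)|IDLE-FOR-NODE); filed by the hp-8 lineage under RULING M-11 (family P-hp8).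
-/

noncomputable section

open MeasureTheory
open scoped Classical

namespace Summit.CriticalPhenomena.PercolationContinuityZ3.Theorems.Transplant

namespace PlanarSkeletonFrmFrom

open Literature.Probability.Percolation Literature.Probability.LatticeModels KNLevels
open Literature.Barriers.CriticalPhenomena (HasExponentialGrowth)
open SkelConc (Consts)

variable {V : Type} [DecidableEq V] [Countable V] {G : SimpleGraph V} [G.LocallyFinite]

export PlanarSkeletonFrm (hchain_of_chainFactQT)

/-- **`FaceHoldsRNQFnLT Lf dT 𝒞₀` from the per-point face residue** (tuple-generic glue over `ChoiceFnNQ`; N2 twin of `faceHoldsRNOFnL_of_residue`):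
at every `(κ, G, Φ, t, p, hC, O, q)` with `FlatQ`, `ChainFactQT … (dT κ.δ₂)` and `AtQNQ`, the residue
`Skelφ.FaceOblRMOF G (scheme O q) (FD O q) Φ.Δ κ.δ₂` of the choice function's scheme / face data gives the obligation. [folklore] -/
theorem faceHoldsRNQFnLT_of_residue (Lf : ℕ → ℕ) (dT : ℝ → ℝ) (𝒞₀ : ChoiceFnNQ)
    (h : ∀ (κ : Consts) {V : Type} [DecidableEq V] [Countable V] (G : SimpleGraph V) [G.LocallyFinite] (Φ : PlanarSkeletonFrmFrom G)
      (hg : ¬ HasExponentialGrowth G) (t : V) (ht : t ∈ Φ.types) (h1 : Φ.types = {t}) (p : unitInterval) (hp0 : 0 < (p : ℝ)) (hp1 : (p : ℝ) < 1)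
      (hC : Φ.CylSubcritical p) (O : Skelφ.StepI.OutNS V) (q : unitInterval),
      FlatQ Lf κ → ChainFactQT Lf G Φ.Δ κ (dT κ.δ₂) → (𝒞₀ κ G Φ hg t ht h1 p hp0 hp1 hC).AtQNQ O q →
        Skelφ.FaceOblRMOF G ((𝒞₀ κ G Φ hg t ht h1 p hp0 hp1 hC).scheme O q) ((𝒞₀ κ G Φ hg t ht h1 p hp0 hp1 hC).FD O q) Φ.Δ κ.δ₂) :
    FaceHoldsRNQFnLT Lf dT 𝒞₀ :=
  fun κ _ _ _ G _ Φ hg t ht h1 p hp0 hp1 hC hFl hCF O q hAt => h κ G Φ hg t ht h1 p hp0 hp1 hC O q hFl hCF hAt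

end PlanarSkeletonFrmFrom

end Summit.CriticalPhenomena.PercolationContinuityZ3.Theorems.Transplant

end
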